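import Summits.QuantumFields.YangMills.Theorems.UnitScaleGibbsLinProxySU2Letters
import Summits.QuantumFields.YangMills.Theorems.UnitScaleGibbsTruncatedPotentialCollarMass
import Summits.QuantumFields.YangMills.Theorems.UnitScaleGibbsTemporalGaugePrimitiveTorus
import Literature.MathematicalPhysics.QuantumFieldTheory.Balaban1983to89.BlockAveragingFederbush
import HarnessLib

/-!
# `GrossTransferStubLinTestAssembly` — THE ASSEMBLY ROWS OF KNIT-E2's (R8-P8) for `stub_linTest` (LINE 28 «GrossTransfer», reference orientation `(1,2)`;
# crux `UnitScaleTilt.HistoryTailL` stmt-QuantumFields-19936 ∕ `MeanDeviationL` stmt-QuantumFields-23083)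

Cell `ym3-torus` (YM ladder rung R3 = continuum SU(2) Yang–Mills on the three-torus — a RUNG, NOT the Clay problem: not d = 4, not infinite
volume, not a mass gap); width seat `ym-ust-19936-w2` (gen 16), helper `--supports stmt-QuantumFields-23083` (★★OWNER WORD 65: the pen of
`main_estimate` consumes these rows BY NAME).  THEOREMS ONLY (0 `def`, 0 `sorry`, default heartbeats).  Six instance-free rows — every exported
inequality is between REAL numbers (`dist₁`, `Re tr`, finite sums of `|·|`), so the Frobenius-scoped package file can use them without meeting the
operator norm (KNIT-PLAN v3, «ARCHITECTURE PITFALL (norm scopes)»):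

* §1 ★★ `sq_le_of_rows` — THE SQUARES (pure real algebra).  From the chain `D ≤ Σ_α|T_α| + Q + ρ` (P1∕P2), `2T_α = SD_α + B_α − Coll_α` (P3∕P4),
  `|Y_α + ¼SD_α| ≤ E_SD` (P5, ✓`sd_term_le`), `|B_α| ≤ E_B` (P6, ✓`bianchi_term_le_of_letters`), `Coll_α² ≤ 128·WX + 2·E_C²` (P7,
  ✓`collar_term_sq_le_of_letters`): `D² ≤ 36·Σ_α Y_α² + 864·WX + 3·(6E_SD + (3∕2)E_B + Q + ρ + 3E_C)²` — the origin of the pen's letter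
  `ω := (9∕2)·push(192·W·|δσ|)` (`864 = (9∕2)·192`).
* §2 ★ `sq_le_of_window` — THE WINDOW: `A ≤ c·L^a·θ²`, `θ = y⁶`, `y¹⁶ = x`, `L^a'·x^b ≤ 1` whenever `a' ≤ K·b`, and `4a ≤ K` ⇒ `A² ≤ c²·x`
  (every non-Schwinger–Dyson, non-collar amplitude of (P8) is quadratic in `θ`, so its square carries `θ⁴ = x·y⁸`).
* §3 ★★ `dist1_le_pauli_read` — THE PROXY READ-OUT IN `dist₁` LETTERS (operator norm inside, none outside): if `‖(X − 1) − Σ_p c_p•(U_p − 1)‖ ≤ ρ`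
  (✓P-LOC's conclusion) then `dist₁ X ≤ Σ_α |Σ_p c_p·Re tr(τ_α(U_p − 1))| + ½Σ_p|c_p|·dist₁(U_p)² + ρ` and `0 ≤ ρ` (✓LIN-ID `norm_sum_smul_sub_one_le`,
  ✓`re_trace_mul_sum_smul`, ✓`FederbushMean.dist1_SU_eq`); `dist1_le_of_linProxy` = the same with the traces of the proxy undistributed (px13 g12's socket shape).
* §4 `half_sum_abs_mul_sq_le` — the second-order proxy term: `½Σ_p|c_p|·g_p² ≤ ½(Σ_p c_p)·θ²` for `c ≥ 0`, `0 ≤ g_p ≤ θ` where `c_p ≠ 0`.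
* §5 ★★ `sigma_mass_le` — THE COLLAR's `ℓ¹` MASS on `ℤ³` (the letters of ✓`UnitScaleGibbsTruncatedPotentialCollarMass`): for the cutoff commutators
  `σ = E₁ − C₂` of a cutoff `χ` (`χ = 1` on `box p R`, `ρ`-Lipschitz both ways) against the Green potential `a = δ₂β`, `γ = d₂β`, `β = (G∕2)∗ω`:
  `Σ_{x∈B}Σ_μΣ_ν|σ(x,μ,ν)| ≤ #B·45·ρ·(3∕2)(C₁∕N²)·M₀` (`N ≥ 1`, `N + ℓ + 4 ≤ R`; ✓MONOPOLE `abs_potential_le_far_monopole` ∕ `abs_dTwo_le_far_monopole`,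
  ✓`far_points`, ✓`abs_curl_comm_le` ∕ `abs_deltaThree_comm_le`, plateau rows ✓`curl_comm_eq_zero_of_mem_box` ∕ `deltaThree_comm_eq_zero_of_mem_box`).
* §6 ★ `sum_box_mul_le_sum_pbond` — THE COLLAR WEIGHTS READ BACK FROM BELOW: for the push `A` of a non-negative `f` onto the dressing box
  `lo = z₀ − (3R+2)`, `hi = z₀ + (3R+4)` and any `G ≥ 0` on bonds: `Σ_{y∈Q_{3R+2}(z₀)}Σ_μ f(y,μ)·G⟨castSite y, μ⟩ ≤ Σ_b A b·G b` (✓`sum_pbond_eq_sum_box`).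

HONEST SCOPE.  Finite-dimensional algebra and finite-sum bookkeeping over landed files by name; NOTHING of `main_estimate`, `stub_linTest`, the other
stubs of LINE 28, (Q), 23083∕23133∕23134, `MeanDeviationL`, `HistoryTailL` (stmt-QuantumFields-19936), the rung R3, d = 4, a continuum limit or a
mass gap is proved here; the Yang–Mills mass gap is NOT proved.
References: L. Gross, CMP 92 (1983) 137–162, Thm 2.2 [GrossCMP1983]; T. Bałaban, CMP 98 (1985) 17–51, (19) p. 21 [Balaban1985Averaging];
CMP 96 (1984) 223–250, (1.9) p. 226 [Balaban1984PropagatorsII].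
-/

noncomputable section

set_option autoImplicit false

open scoped BigOperators Matrix.Norms.L2Operator
open Complex Finset
open Literature.MathematicalPhysics.QuantumFieldTheory.Balaban1983to89
open Literature.MathematicalPhysics.QuantumFieldTheory.Balaban1983to89.B4Eq19LatticeOperators (Zd unitVec box mem_box box_mono
  abs_unitVec_apply_le)
open Literature.MathematicalPhysics.QuantumFieldTheory.Balaban1983to89.T4AxialGaugeSmallField (castSite)
open Literature.MathematicalPhysics.QuantumFieldTheory.Balaban1983to89.B7Prop1Explicit (e)
open Literature.MathematicalPhysics.QuantumFieldTheory.Balaban1983to89.B10Eq18SigmaSU2 (pauli)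
open Literature.Probability.LatticeModels (latticeGreen)
open Summit.QuantumFields.YangMills.Theorems.UnitScaleGibbsLinProxySU2Letters (norm_sum_smul_sub_one_le re_trace_mul_sum_smul)
open Summit.QuantumFields.YangMills.Theorems.CovariantDischargeCutoffCommutator (abs_curl_comm_le abs_deltaThree_comm_le
  curl_comm_eq_zero_of_mem_box deltaThree_comm_eq_zero_of_mem_box)
open Summit.QuantumFields.YangMills.Theorems.UnitScaleGibbsGreenPotentialMonopoleFarField (abs_potential_le_far_monopole abs_dTwo_le_far_monopole)
open Summit.QuantumFields.YangMills.Theorems.UnitScaleGibbsTruncatedPotentialCollarMass (far_points)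
open Summit.QuantumFields.YangMills.Theorems.UnitScaleGibbsTemporalGaugePrimitiveTorus (sum_pbond_eq_sum_box)

namespace Summit.QuantumFields.YangMills.Theorems.GrossTransferStubLinTestAssembly

/-! ## §1 The squares (pure real algebra) -/

/-- `(Σ_{α<3}|f α|)² ≤ 3·Σ_{α<3}(f α)²` (Cauchy–Schwarz on three terms). [folklore] -/
theorem sq_sum_abs_fin_three_le (f : Fin 3 → ℝ) : (∑ α, |f α|) ^ 2 ≤ 3 * ∑ α, f α ^ 2 := by
  simp only [Fin.sum_univ_three]
  rw [← sq_abs (f 0), ← sq_abs (f 1), ← sq_abs (f 2)]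
  nlinarith [sq_nonneg (|f 0| - |f 1|), sq_nonneg (|f 1| - |f 2|), sq_nonneg (|f 0| - |f 2|)]

/-- ★★ **THE SQUARES OF (R8-P8).**  Real letters: `D = dist₁` of the block plaquette, `T_α` the three Pauli pairings of the linear proxy, `Q` its second-order
term, `ρ` the P-LOC remainder, `SD_α`∕`B_α`∕`Coll_α` the Schwinger–Dyson∕Bianchi∕collar pieces of the cutoff-potential identity (`2T_α = SD_α + B_α − Coll_α`),
`Y_α` the SD observables (`|Y_α + ¼SD_α| ≤ E_SD`), `|B_α| ≤ E_B`, `Coll_α² ≤ 128·WX + 2·E_C²` (✓KNIT-E4).  Then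
`D² ≤ 36·Σ_α Y_α² + 864·WX + 3·(6E_SD + (3∕2)E_B + Q + ρ + 3E_C)²`. [cite: GrossCMP1983, Thm 2.2] -/
theorem sq_le_of_rows {D Q ρ WX EC ESD EB : ℝ} {T Y SD B Coll : Fin 3 → ℝ}
    (hD0 : 0 ≤ D) (h12 : D ≤ ∑ α, |T α| + Q + ρ)
    (h3 : ∀ α, 2 * T α = SD α + B α - Coll α) (h4 : ∀ α, |Y α + 1 / 4 * SD α| ≤ ESD) (h5 : ∀ α, |B α| ≤ EB)
    (h6 : ∀ α, Coll α ^ 2 ≤ 128 * WX + 2 * EC ^ 2) (hEC : 0 ≤ EC) (hQ : 0 ≤ Q) (hρ : 0 ≤ ρ) :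
    D ^ 2 ≤ 36 * ∑ α, Y α ^ 2 + 864 * WX + 3 * (6 * ESD + 3 / 2 * EB + Q + ρ + 3 * EC) ^ 2 := by
  have hESD : 0 ≤ ESD := (abs_nonneg _).trans (h4 0)
  have hEB : 0 ≤ EB := (abs_nonneg _).trans (h5 0)
  -- per-`α`: `|T_α| ≤ 2|Y_α| + 2E_SD + E_B∕2 + |Coll_α|∕2`
  have hT : ∀ α, |T α| ≤ 2 * |Y α| + 2 * ESD + EB / 2 + |Coll α| / 2 := by
    intro α
    have e3 := h3 α
    have hZ := abs_le.mp (h4 α)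
    have hB' := abs_le.mp (h5 α)
    have hY1 := le_abs_self (Y α)
    have hY2 := neg_abs_le (Y α)
    have hC1 := le_abs_self (Coll α)
    have hC2 := neg_abs_le (Coll α)
    rw [abs_le]
    constructor <;> linarith [hZ.1, hZ.2, hB'.1, hB'.2]
  have hY := sq_sum_abs_fin_three_le Y
  have hC := sq_sum_abs_fin_three_le Coll
  simp only [Fin.sum_univ_three] at h12 hY hC ⊢
  obtain ⟨E₀, hE₀⟩ : ∃ E₀ : ℝ, E₀ = 6 * ESD + 3 / 2 * EB + Q + ρ := ⟨_, rfl⟩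
  have hE₀0 : 0 ≤ E₀ := by rw [hE₀]; linarith
  obtain ⟨SY, hSY⟩ : ∃ SY : ℝ, SY = |Y 0| + |Y 1| + |Y 2| := ⟨_, rfl⟩
  obtain ⟨SC, hSC⟩ : ∃ SC : ℝ, SC = |Coll 0| + |Coll 1| + |Coll 2| := ⟨_, rfl⟩
  rw [← hSY] at hY
  rw [← hSC] at hC
  have hDM : D ≤ 2 * SY + SC / 2 + E₀ := by
    rw [hSY, hSC, hE₀]; linarith [hT 0, hT 1, hT 2, h12]
  have hsq : D ^ 2 ≤ (2 * SY + SC / 2 + E₀) ^ 2 := pow_le_pow_left₀ hD0 hDM 2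
  have h3sq : (2 * SY + SC / 2 + E₀) ^ 2 ≤ 12 * SY ^ 2 + 3 / 4 * SC ^ 2 + 3 * E₀ ^ 2 := by
    nlinarith [sq_nonneg (2 * SY - SC / 2), sq_nonneg (SC / 2 - E₀), sq_nonneg (2 * SY - E₀)]
  have hC' : Coll 0 ^ 2 + Coll 1 ^ 2 + Coll 2 ^ 2 ≤ 3 * (128 * WX + 2 * EC ^ 2) := by linarith [h6 0, h6 1, h6 2]
  have hfin : 3 * E₀ ^ 2 + 27 / 2 * EC ^ 2 ≤ 3 * (E₀ + 3 * EC) ^ 2 := by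
    nlinarith [mul_nonneg hE₀0 hEC, sq_nonneg EC]
  rw [← hE₀]
  linarith [hsq, h3sq, hY, hC, hC', hfin]

/-! ## §2 The window -/

/-- ★ **THE WINDOW FOR A `θ²`-AMPLITUDE.**  With `1 ≤ L`, `0 ≤ y`, `y¹⁶ = x`, `θ = y⁶`, the pen's window `∀ a b, a ≤ K·b → L^a·x^b ≤ 1`, and an amplitude
`0 ≤ A ≤ c·L^a·θ²` with `4a ≤ K`: `A² ≤ c²·x` — because `A² ≤ c²·L^{2a}·θ⁴ = c²·x·(L^{2a}y⁸)` and `(L^{2a}y⁸)² = L^{4a}·x ≤ 1`.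
[cite: GrossCMP1983, Thm 2.2] -/
theorem sq_le_of_window {L x y θ A c : ℝ} {K a : ℕ} (hL : 1 ≤ L) (hy : 0 ≤ y) (hy16 : y ^ 16 = x) (hθ : θ = y ^ 6)
    (hwin : ∀ a b : ℕ, a ≤ K * b → L ^ a * x ^ b ≤ 1) (hA0 : 0 ≤ A) (hA : A ≤ c * L ^ a * θ ^ 2)
    (ha : 4 * a ≤ K) : A ^ 2 ≤ c ^ 2 * x := by
  have hx0 : 0 ≤ x := by rw [← hy16]; exact pow_nonneg hy 16
  have hL0 : 0 ≤ L := zero_le_one.trans hL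
  have hz0 : 0 ≤ L ^ (2 * a) * y ^ 8 := mul_nonneg (pow_nonneg hL0 _) (pow_nonneg hy 8)
  have hz1 : L ^ (2 * a) * y ^ 8 ≤ 1 := by
    have h2 : (L ^ (2 * a) * y ^ 8) ^ 2 ≤ 1 := by
      have e1 : (L ^ (2 * a) * y ^ 8) ^ 2 = L ^ (4 * a) * x ^ 1 := by
        rw [mul_pow, ← pow_mul, ← pow_mul, pow_one, show 2 * a * 2 = 4 * a by ring, show (8 * 2 : ℕ) = 16 by norm_num, hy16]
      rw [e1]
      exact hwin (4 * a) 1 (by omega)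
    exact (pow_le_one_iff_of_nonneg hz0 (by norm_num : (2 : ℕ) ≠ 0)).mp h2
  have hθ4 : (θ ^ 2) ^ 2 = y ^ 8 * x := by rw [hθ, ← hy16]; ring
  have hc2x : 0 ≤ c ^ 2 * x := mul_nonneg (sq_nonneg c) hx0
  calc A ^ 2 ≤ (c * L ^ a * θ ^ 2) ^ 2 := pow_le_pow_left₀ hA0 hA 2
    _ = c ^ 2 * x * (L ^ (2 * a) * y ^ 8) := by
        rw [mul_pow, mul_pow, hθ4, ← pow_mul, show a * 2 = 2 * a by ring]; ring
    _ ≤ c ^ 2 * x * 1 := mul_le_mul_of_nonneg_left hz1 hc2x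
    _ = c ^ 2 * x := mul_one _

/-- **THE WINDOW, AMPLITUDE FORM WITH `L^j` ON THE RIGHT**: under the same letters, `A² ≤ c²·(x·L^j)` for every `j` (`1 ≤ L`). [cite: GrossCMP1983, Thm 2.2] -/
theorem sq_le_of_window' {L x y θ A c : ℝ} {K a : ℕ} (j : ℕ) (hL : 1 ≤ L) (hy : 0 ≤ y) (hy16 : y ^ 16 = x) (hθ : θ = y ^ 6)
    (hwin : ∀ a b : ℕ, a ≤ K * b → L ^ a * x ^ b ≤ 1) (hA0 : 0 ≤ A) (hA : A ≤ c * L ^ a * θ ^ 2)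
    (ha : 4 * a ≤ K) : A ^ 2 ≤ c ^ 2 * (x * L ^ j) := by
  have hx0 : 0 ≤ x := by rw [← hy16]; exact pow_nonneg hy 16
  have h := sq_le_of_window hL hy hy16 hθ hwin hA0 hA ha
  have hLj : (1 : ℝ) ≤ L ^ j := one_le_pow₀ hL
  have hcx : 0 ≤ c ^ 2 * x := mul_nonneg (sq_nonneg c) hx0
  calc A ^ 2 ≤ c ^ 2 * x := h
    _ = c ^ 2 * x * 1 := (mul_one _).symm
    _ ≤ c ^ 2 * x * L ^ j := mul_le_mul_of_nonneg_left hLj hcx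
    _ = c ^ 2 * (x * L ^ j) := by ring

/-! ## §3 The proxy read-out in `dist₁` letters -/

/-- ★★ **THE LINEAR PROXY READ IN `dist₁` LETTERS.**  `X, U_p ∈ SU(2)`, real coefficients `c_p`: if `‖(X − 1) − Σ_p c_p•(U_p − 1)‖ ≤ ρ` (operator norm;
✓P-LOC's conclusion) then `dist₁ X ≤ Σ_α |Σ_p c_p·Re tr((iσ_α)(U_p − 1))| + ½Σ_p |c_p|·dist₁(U_p)² + ρ` and `0 ≤ ρ`
(✓`norm_sum_smul_sub_one_le` + linearity of the Pauli traces + `dist₁ = ‖· − 1‖` on `SU(2)`). [cite: Balaban1985Averaging, (19) p.21] -/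
theorem dist1_le_pauli_read {ι : Type*} (s : Finset ι) (c : ι → ℝ)
    (U : ι → Matrix.specialUnitaryGroup (Fin 2) ℂ) (X : Matrix.specialUnitaryGroup (Fin 2) ℂ) {ρ : ℝ}
    (h : ‖((X : Matrix (Fin 2) (Fin 2) ℂ) - 1) - ∑ p ∈ s, ((c p : ℝ) : ℂ) • ((U p : Matrix (Fin 2) (Fin 2) ℂ) - 1)‖ ≤ ρ) :
    GaugeGroup.dist1 X ≤ ∑ α : Fin 3, |∑ p ∈ s, c p * ((I • pauli α) * ((U p : Matrix (Fin 2) (Fin 2) ℂ) - 1)).trace.re|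
      + (1 / 2) * ∑ p ∈ s, |c p| * GaugeGroup.dist1 (U p) ^ 2 + ρ ∧ 0 ≤ ρ := by
  have hρ : 0 ≤ ρ := (norm_nonneg _).trans h
  refine ⟨?_, hρ⟩
  have htri := norm_le_insert' ((X : Matrix (Fin 2) (Fin 2) ℂ) - 1) (∑ p ∈ s, ((c p : ℝ) : ℂ) • ((U p : Matrix (Fin 2) (Fin 2) ℂ) - 1))
  have hP2 := norm_sum_smul_sub_one_le s c U
  have hP2' : ∀ α : Fin 3, ((I • pauli α) * ∑ p ∈ s, ((c p : ℝ) : ℂ) • ((U p : Matrix (Fin 2) (Fin 2) ℂ) - 1)).trace.re =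
      ∑ p ∈ s, c p * ((I • pauli α) * ((U p : Matrix (Fin 2) (Fin 2) ℂ) - 1)).trace.re := fun α =>
    re_trace_mul_sum_smul s (I • pauli α) c _
  have hd : ∀ p, ‖(U p : Matrix (Fin 2) (Fin 2) ℂ) - 1‖ = GaugeGroup.dist1 (U p) := fun p => (FederbushMean.dist1_SU_eq (U p)).symm
  simp only [hP2', hd] at hP2
  rw [FederbushMean.dist1_SU_eq X]
  linarith [htri, hP2, h]

/-- ★★ **THE SAME READ-OUT, UNDISTRIBUTED SHAPE** (the socket asked for by the pen of `main_estimate`, px13 g12 00:40:51Z): under the same hypothesis,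
`dist₁ g ≤ Σ_α |Re tr((iσ_α)·Σ_p c_p•(U_p − 1))| + ½Σ_p |c_p|·dist₁(U_p)² + ρ` (the Pauli traces of the proxy itself; distribute with ✓`re_trace_mul_sum_smul`).
[cite: Balaban1985Averaging, (19) p.21] -/
theorem dist1_le_of_linProxy {ι : Type*} (s : Finset ι) (c : ι → ℝ)
    (Up : ι → Matrix.specialUnitaryGroup (Fin 2) ℂ) (g : Matrix.specialUnitaryGroup (Fin 2) ℂ) {ρ : ℝ}
    (h : ‖((g : Matrix (Fin 2) (Fin 2) ℂ) - 1) - ∑ p ∈ s, ((c p : ℝ) : ℂ) • ((Up p : Matrix (Fin 2) (Fin 2) ℂ) - 1)‖ ≤ ρ) :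
    GaugeGroup.dist1 g ≤ ∑ α : Fin 3, |((I • pauli α) * ∑ p ∈ s, ((c p : ℝ) : ℂ) • ((Up p : Matrix (Fin 2) (Fin 2) ℂ) - 1)).trace.re|
      + (1 / 2) * ∑ p ∈ s, |c p| * GaugeGroup.dist1 (Up p) ^ 2 + ρ := by
  have hP2' : ∀ α : Fin 3, ((I • pauli α) * ∑ p ∈ s, ((c p : ℝ) : ℂ) • ((Up p : Matrix (Fin 2) (Fin 2) ℂ) - 1)).trace.re =
      ∑ p ∈ s, c p * ((I • pauli α) * ((Up p : Matrix (Fin 2) (Fin 2) ℂ) - 1)).trace.re := fun α =>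
    re_trace_mul_sum_smul s (I • pauli α) c _
  simp only [hP2']
  exact (dist1_le_pauli_read s c Up g h).1

/-! ## §4 The second-order proxy term -/

/-- `½Σ_p|c_p|·g_p² ≤ ½·(Σ_p c_p)·θ²` for `c ≥ 0` on `s`, `0 ≤ g`, and `g_p ≤ θ` wherever `c_p ≠ 0`. [folklore] -/
theorem half_sum_abs_mul_sq_le {ι : Type*} (s : Finset ι) (c g : ι → ℝ) {θ : ℝ}
    (hc : ∀ p ∈ s, 0 ≤ c p) (hg0 : ∀ p ∈ s, 0 ≤ g p) (hg : ∀ p ∈ s, c p ≠ 0 → g p ≤ θ) :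
    (1 / 2) * ∑ p ∈ s, |c p| * g p ^ 2 ≤ (1 / 2) * (∑ p ∈ s, c p) * θ ^ 2 := by
  rw [mul_assoc, Finset.sum_mul]
  refine mul_le_mul_of_nonneg_left (Finset.sum_le_sum fun p hp => ?_) (by norm_num)
  by_cases h0 : c p = 0
  · rw [h0, abs_zero, zero_mul, zero_mul]
  · rw [abs_of_nonneg (hc p hp)]
    exact mul_le_mul_of_nonneg_left (pow_le_pow_left₀ (hg0 p hp) (hg p hp h0) 2) (hc p hp)

/-! ## §5 The collar's `ℓ¹` mass on `ℤ³` -/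

/-- ★★ **THE `ℓ¹` MASS OF THE CUTOFF COMMUTATORS `σ = E₁ − C₂`** (letters of ✓`UnitScaleGibbsTruncatedPotentialCollarMass`: `ω` on `box p ℓ`, `β = (G∕2)∗ω`,
`a = δ₂β`, `γ = d₂β`, kernel row (H1) with constant `C₁ ≥ 0`; cutoff `χ = 1` on `box p R`, `ρ`-Lipschitz forwards and backwards; `N ≥ 1`, `N + ℓ + 4 ≤ R`):
for every finite `B ⊆ ℤ³`, `Σ_{x∈B}Σ_μΣ_ν|σ(x,μ,ν)| ≤ #B·(45·ρ·((3∕2)·(C₁∕N²)·M₀))`, `M₀ = Σ_{μν}Σ_{y∈box p ℓ}|ω(y,μ,ν)|` — on the plateau `box p (R−1)` the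
commutators vanish, off it every `a`∕`γ` letter is far (✓`far_points`) and MONOPOLE-small. [cite: Balaban1984PropagatorsII, (1.9) p.226] -/
theorem sigma_mass_le {C₁ : ℝ} (hC₁ : 0 ≤ C₁)
    (hK1 : ∀ (e : Fin 3) (w : Zd 3) (n : ℕ), 1 ≤ n → w ∉ box (0 : Zd 3) ((n : ℤ) - 1) →
      |latticeGreen (w + unitVec e) - latticeGreen w| ≤ C₁ / (n : ℝ) ^ 2)
    (ω β : Zd 3 → Fin 3 → Fin 3 → ℝ) (a : Zd 3 → Fin 3 → ℝ) (γ : Zd 3 → Fin 3 → Fin 3 → Fin 3 → ℝ) (p : Zd 3) (ℓ : ℕ)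
    (hβ : ∀ x μ ν, β x μ ν = ∑ y ∈ box p ℓ, latticeGreen (x - y) / 2 * ω y μ ν)
    (ha : ∀ x ν, a x ν = ∑ μ, (β (x - unitVec μ) μ ν - β x μ ν))
    (hγ : ∀ x κ μ ν, γ x κ μ ν = (β (x + unitVec κ) μ ν - β x μ ν) - (β (x + unitVec μ) κ ν - β x κ ν) + (β (x + unitVec ν) κ μ - β x κ μ))
    (χ : Zd 3 → ℝ) (E1 C2 σ : Zd 3 → Fin 3 → Fin 3 → ℝ)
    (hE1 : ∀ x μ ν, E1 x μ ν = (χ (x + unitVec μ) - χ x) * a (x + unitVec μ) ν - (χ (x + unitVec ν) - χ x) * a (x + unitVec ν) μ)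
    (hC2 : ∀ x μ ν, C2 x μ ν = ∑ κ, (χ x - χ (x - unitVec κ)) * γ (x - unitVec κ) κ μ ν)
    (hσ : ∀ x μ ν, σ x μ ν = E1 x μ ν - C2 x μ ν)
    (R : ℕ) {ρ : ℝ} (hχ1 : ∀ y ∈ box p (R : ℤ), χ y = 1)
    (hχp : ∀ x (μ : Fin 3), |χ (x + unitVec μ) - χ x| ≤ ρ) (hχm : ∀ x (μ : Fin 3), |χ (x - unitVec μ) - χ x| ≤ ρ)
    (N : ℕ) (hN : 1 ≤ N) (hNR : (N : ℤ) + ℓ + 4 ≤ R) (B : Finset (Zd 3)) :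
    ∑ x ∈ B, ∑ μ, ∑ ν, |σ x μ ν|
      ≤ (B.card : ℝ) * (45 * ρ * (3 / 2 * (C₁ / (N : ℝ) ^ 2) * ∑ μ', ∑ ν', ∑ y' ∈ box p (ℓ : ℤ), |ω y' μ' ν'|)) := by
  classical
  obtain ⟨As, hAs⟩ : ∃ As : ℝ, As = 3 / 2 * (C₁ / (N : ℝ) ^ 2) * ∑ μ', ∑ ν', ∑ y' ∈ box p (ℓ : ℤ), |ω y' μ' ν'| := ⟨_, rfl⟩
  rw [← hAs]
  have hρ0 : 0 ≤ ρ := (abs_nonneg _).trans (hχp p 0)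
  have hM₀0 : 0 ≤ ∑ μ', ∑ ν', ∑ y' ∈ box p (ℓ : ℤ), |ω y' μ' ν'| :=
    sum_nonneg fun _ _ => sum_nonneg fun _ _ => sum_nonneg fun _ _ => abs_nonneg _
  have hAs0 : 0 ≤ As := by rw [hAs]; positivity
  have hfarA : ∀ y, y ∉ box p ((N : ℤ) + ℓ) → ∀ ν, |a y ν| ≤ As := fun y hy ν => by
    rw [hAs]; exact abs_potential_le_far_monopole hK1 ω β a p ℓ hβ ha hC₁ y ν N hN hy
  have hfarG : ∀ y, y ∉ box p ((N : ℤ) + ℓ) → ∀ κ μ ν, |γ y κ μ ν| ≤ As := fun y hy κ μ ν => by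
    rw [hAs]
    exact abs_dTwo_le_far_monopole hK1 ω β γ p ℓ hβ hγ hC₁ y κ μ ν N hN (fun h' => hy (box_mono p (by linarith) h'))
  have hQR : (N : ℤ) + ℓ + 4 ≤ (R : ℤ) := hNR
  -- pointwise: `Σ_μΣ_ν |σ x μ ν| ≤ 45·ρ·As`
  have hpt : ∀ x, ∑ μ, ∑ ν, |σ x μ ν| ≤ 45 * ρ * As := by
    intro x
    by_cases hx : x ∈ box p ((R : ℤ) - 1)
    · have h0 : ∀ μ ν, σ x μ ν = 0 := fun μ ν => by
        rw [hσ, hE1, hC2, curl_comm_eq_zero_of_mem_box hχ1 hx a μ ν, deltaThree_comm_eq_zero_of_mem_box hχ1 hx γ μ ν, sub_zero]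
      simp only [h0, abs_zero, sum_const_zero]
      positivity
    · have hx2 : x ∉ box p ((R : ℤ) - 2) := fun h' => hx (box_mono p (by linarith) h')
      have hterm : ∀ μ ν, |σ x μ ν| ≤ ρ * (As + As) + ρ * (As + As + As) := by
        intro μ ν
        rw [hσ, hE1, hC2]
        refine (abs_sub _ _).trans (add_le_add ?_ ?_)
        · refine (abs_curl_comm_le hχp a x μ ν).trans (mul_le_mul_of_nonneg_left (add_le_add ?_ ?_) hρ0)
          · obtain ⟨-, hxp, -, -, -⟩ := far_points p (R : ℤ) ((N : ℤ) + ℓ) hQR hx2 μ ν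
            exact hfarA _ hxp ν
          · obtain ⟨-, hxp, -, -, -⟩ := far_points p (R : ℤ) ((N : ℤ) + ℓ) hQR hx2 ν μ
            exact hfarA _ hxp μ
        · refine (abs_deltaThree_comm_le hχm γ x μ ν).trans (mul_le_mul_of_nonneg_left ?_ hρ0)
          calc ∑ κ : Fin 3, |γ (x - unitVec κ) κ μ ν| ≤ ∑ _κ : Fin 3, As := sum_le_sum fun κ _ => by
                  obtain ⟨-, -, hxm, -, -⟩ := far_points p (R : ℤ) ((N : ℤ) + ℓ) hQR hx2 κ κ
                  exact hfarG _ hxm κ μ ν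
            _ = As + As + As := by simp only [sum_const, card_univ, Fintype.card_fin, nsmul_eq_mul]; ring
      calc ∑ μ : Fin 3, ∑ ν : Fin 3, |σ x μ ν| ≤ ∑ _μ : Fin 3, ∑ _ν : Fin 3, (ρ * (As + As) + ρ * (As + As + As)) :=
            sum_le_sum fun μ _ => sum_le_sum fun ν _ => hterm μ ν
        _ = 45 * ρ * As := by simp only [sum_const, card_univ, Fintype.card_fin, nsmul_eq_mul]; ring
  calc ∑ x ∈ B, ∑ μ, ∑ ν, |σ x μ ν| ≤ ∑ _x ∈ B, 45 * ρ * As := sum_le_sum fun x _ => hpt x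
    _ = (B.card : ℝ) * (45 * ρ * As) := by rw [sum_const, nsmul_eq_mul]

/-! ## §6 The collar weights read back from below -/

/-- ★ **A NON-NEGATIVE PUSH DOMINATES ITS `Q_{3R+2}` READ-OUT**: for the push `A` of `f ≥ 0` onto the dressing box `lo = z₀ − (3R+2)`, `hi = z₀ + (3R+4)`
(the two reading rows of ✓`exists_push`) and any `G ≥ 0` on bonds, `Σ_{y∈Q_{3R+2}(z₀)}Σ_μ f(y,μ)·G⟨castSite y,μ⟩ ≤ Σ_b A b·G b` — every `(y,μ)` there is a box bond
on which the push reads `f`, distinct pairs give distinct bonds (✓`sum_pbond_eq_sum_box`), and the other terms are `≥ 0`. [cite: Balaban1984PropagatorsI, (1.10) p.19] -/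
theorem sum_box_mul_le_sum_pbond {P : Params} {j : ℕ} {lo hi : Fin P.d → ℤ} (hN : ∀ κ, hi κ - lo κ < P.sitesPerDir j)
    (z₀ : Zd P.d) (R : ℕ) (hlo : ∀ κ, lo κ = z₀ κ - (3 * (R : ℤ) + 2)) (hhi : ∀ κ, hi κ = z₀ κ + (3 * (R : ℤ) + 4))
    (f : Zd P.d → Fin P.d → ℝ) (hf : ∀ x μ, 0 ≤ f x μ) (A : PBond P j → ℝ)
    (hA : ∀ (x : Fin P.d → ℤ) (μ : Fin P.d), lo ≤ x → x + e μ ≤ hi → A ⟨castSite x, μ⟩ = f x μ)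
    (hA0 : ∀ b : PBond P j, (¬ ∃ y : Fin P.d → ℤ, lo ≤ y ∧ y + e b.dir ≤ hi ∧ b.src = castSite y) → A b = 0)
    (G : PBond P j → ℝ) (hG : ∀ b, 0 ≤ G b) :
    ∑ y ∈ box z₀ (3 * (R : ℤ) + 2), ∑ μ, f y μ * G ⟨castSite y, μ⟩ ≤ ∑ b : PBond P j, A b * G b := by
  classical
  have hApos : ∀ b : PBond P j, 0 ≤ A b := by
    intro b
    by_cases h : ∃ y : Fin P.d → ℤ, lo ≤ y ∧ y + e b.dir ≤ hi ∧ b.src = castSite y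
    · obtain ⟨y, hy, hyhi, hsrc⟩ := h
      have hb : b = ⟨castSite y, b.dir⟩ := by cases b; simp only at hsrc; simp [hsrc]
      rw [hb, hA y b.dir hy hyhi]; exact hf y b.dir
    · rw [hA0 b h]
  have hrows : ∀ y ∈ box z₀ (3 * (R : ℤ) + 2), lo ≤ y ∧ (∀ μ, y + e μ ≤ hi) ∧ y ∈ Fintype.piFinset (fun i => Finset.Icc (lo i) (hi i)) := by
    intro y hy
    rw [mem_box] at hy
    have h1 : lo ≤ y := fun i => by
      have h := hy i; rw [abs_le] at h; rw [hlo i]; linarith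
    have h2 : ∀ μ, y + e μ ≤ hi := fun μ i => by
      have h := hy i; rw [abs_le] at h
      have hu : (e μ : Zd P.d) i ≤ 1 := le_trans (le_abs_self _) (abs_unitVec_apply_le μ i)
      simp only [Pi.add_apply, hhi i]; linarith
    refine ⟨h1, h2, ?_⟩
    rw [Fintype.mem_piFinset]
    intro i
    rw [Finset.mem_Icc]
    have h := hy i; rw [abs_le] at h
    refine ⟨h1 i, ?_⟩
    rw [hhi i]; linarith
  rw [sum_pbond_eq_sum_box hN (fun b => A b * G b) (fun b hb => by
      by_cases h : ∃ y : Fin P.d → ℤ, lo ≤ y ∧ y + e b.dir ≤ hi ∧ b.src = castSite y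
      · exact h
      · exact absurd (by rw [hA0 b h, zero_mul]) hb)]
  calc ∑ y ∈ box z₀ (3 * (R : ℤ) + 2), ∑ μ, f y μ * G ⟨castSite y, μ⟩
      = ∑ y ∈ box z₀ (3 * (R : ℤ) + 2), ∑ μ, A ⟨castSite y, μ⟩ * G ⟨castSite y, μ⟩ := by
        refine sum_congr rfl fun y hy => sum_congr rfl fun μ _ => ?_
        rw [hA y μ (hrows y hy).1 ((hrows y hy).2.1 μ)]
    _ ≤ ∑ y ∈ Fintype.piFinset (fun i => Finset.Icc (lo i) (hi i)), ∑ μ, A ⟨castSite y, μ⟩ * G ⟨castSite y, μ⟩ :=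
        sum_le_sum_of_subset_of_nonneg (fun y hy => (hrows y hy).2.2) fun y _ _ =>
          sum_nonneg fun μ _ => mul_nonneg (hApos _) (hG _)

end Summit.QuantumFields.YangMills.Theorems.GrossTransferStubLinTestAssembly

end
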